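import Summits.NavierStokesRegularity.NavierStokesRegularity.Theorems.StrainDoorsDirectionDoorK5Closed
import HarnessLib

/-!
# Strain doors, PART M §M23 — THE WINDOWED, THRESHOLD-FREE FIXED-`δ` DIRECTION-COHERENCE LIOUVILLE THEOREM IN `A_M`

ROUND 67 of the `ns-regularity-ideate` p1 line (helper lane of `stmt-NavierStokesRegularity-0056`, rung N0;
nothing here is a claim about Navier–Stokes regularity).  Lane line: «for every Type-I rate `M` and range
`R > 0` there is a FIXED `δ = δ(M,R) > 0` such that a KNSS-gauge Type-I ancient mild solution
(`IsTypeIAncientMild M U`: smooth, divergence-free, Oseen-mild on every window, `|U(s,y)| ≤ M/√(−s)`) whose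
vorticity directions differ by at most `δ` between any two points of the far window `s < −1` where the
vorticity does not vanish and which are at parabolic distance `≤ R√(−s)`, is identically zero».

This is the `A_M`-INTRINSIC form of ROUND 66's `exists_pos_relDirectionCoherence_liouville` (door N5 of the
ROUND-66 memo, `WindowCoherenceLiouville M R`): the class is the blow-up class itself (time envelope only, no
space–time envelope), there is NO vorticity threshold (coherence is asked wherever `ω ≠ 0`), and the hypothesis
is only imposed on the WINDOW `s < −1` — exactly where the tree's local zoom theorem
`LocalTypeIBlowup.exists_typeIAncientMild_zoomLimit` exports the convergence of curls; so this is the engine of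
the blow-up corollary (door N6, §M24).

Proof (★★★ `windowCoherenceLiouville_holds`).  If no `δ` works, pick for `δ_j = 1/(j+1)` a non-zero
`δ_j`-coherent `U_j ∈ A_M`.  (i) `U_j` does not vanish on the far past `s < −2`: otherwise `curl U_j(−3) ≡ 0`
and ROUND 65's `eq_zero_of_typeIAncientMild_of_curl_eq_zero_on_open` kills `U_j`.  (ii) Hence the time-shifted
field `s ↦ U_j(s − 2) ∈ A_M` (`IsTypeIAncientMild.comp_sub_right`) is non-zero, and the small-vorticity-number
Liouville theorem (P1) (`smallVorticityNumberLiouville_holds`, = the tree's `liouville_qw_holds`) NEGATED gives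
a time `τ_j < −2` and a point `y_j` with `(−τ_j)|ω_{U_j}(τ_j, y_j)| > η(M)` — no near-record selection and no
class-uniform vorticity bound are needed.  (iii) Normalise: `v_j(s,y) = λ_j U_j(λ_j² s, λ_j y + y_j)`,
`λ_j = √(−τ_j/2) ≥ 1` (`IsTypeIAncientMild.comp_add_right`, `.nsRescale`): `v_j ∈ A_M`,
`|curl v_j(−2)(0)| = (−τ_j/2)|ω_{U_j}(τ_j,y_j)| > η/2`, and `v_j(−2)` is `δ_j`-coherent for pairs at distance
`≤ R` off its zero set (parabolic invariance of the hypothesis; `λ_j ≥ 1` keeps the slice inside the window).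
(iv) (P2) `typeIAncientCompactness_holds M`: a subsequence converges with curls to `W ∈ A_M`,
`e := curl W(−2)(0)`, `|e| ≥ η/2`; on the OPEN set `B(0,R) ∩ {curl W(−2) ≠ 0} ∋ 0` directions pass to the limit
and are CONSTANT; (v) ROUND 65's one-slice Liouville theorem `eq_zero_of_typeIAncientMild_of_curl_parallel_on_open`
forces `W ≡ 0`, contradicting `e ≠ 0`.

References: Giga–Miura, Comm. Math. Phys. 303 (2011) Thm 1.1, Prop. 2.2, §3; Barker–Prange, Arch. Ration. Mech.
Anal. 2020 (arXiv:1906.08225) Thm 3, §4–§5; Koch–Nadirashvili–Seregin–Šverák, Acta Math. 203 (2009) Thm 5.1,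
Lemma 6.1.
-/

noncomputable section

-- the summit and its single problem share the name `NavierStokesRegularity` (D-0017 nested layout)
set_option linter.dupNamespace false

open MeasureTheory Set Function Filter Metric Real InnerProductSpace
open _root_.Topology
open scoped ENNReal NNReal RealInnerProductSpace ContDiff
open Literature.Analysis Literature.Analysis.FluidPDE
open Literature.Analysis.FluidPDE.VorticityDirectionDynamics

namespace Summit.NavierStokesRegularity.NavierStokesRegularity.Theorems.StrainDoors

/-! ### §M23(a) The statement (door N5 of ROUND 66) -/

/-- **Door N5 — windowed, threshold-free, fixed-`δ` direction-coherence Liouville statement in `A_M`**: some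
`δ > 0` such that every `U ∈ A_M` whose vorticity directions are `δ`-coherent, at every time `s < −1`, between
points where `curl U(s) ≠ 0` at distance `≤ R√(−s)`, vanishes identically. -/
def WindowCoherenceLiouville (M R : ℝ) : Prop :=
  ∃ δ : ℝ, 0 < δ ∧
    ∀ U : ℝ → EuclideanSpace ℝ (Fin 3) → EuclideanSpace ℝ (Fin 3), IsTypeIAncientMild M U →
      (∀ s : ℝ, s < -1 → ∀ x y : EuclideanSpace ℝ (Fin 3),
        curl (U s) x ≠ 0 → curl (U s) y ≠ 0 → ‖y - x‖ ≤ R * √(-s) →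
          ‖vorticityDirection (curl (U s)) y - vorticityDirection (curl (U s)) x‖ ≤ δ) →
      ∀ s : ℝ, s < 0 → ∀ y : EuclideanSpace ℝ (Fin 3), U s y = 0

/-! ### §M23(b) Bookkeeping -/

-- (helper `inv_norm_smul_smul_of_pos₆₇` of the text removed at landing — see the LANDING NOTE at its use.)

/-- **Far-past non-triviality**: a member of `A_M` that is not identically zero has, for the `η(M)` of the
small-vorticity-number Liouville theorem, a time `τ < −2` and a point where `(0 − τ)|ω(τ,·)| > η`.
(Shift time by `2`, apply (P1) to the shifted field; if it vanished, `curl u(−3) ≡ 0` and the one-slice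
Liouville theorem would kill `u`.) [cite: KochNadirashviliSereginSverak2009, Thm 5.1 (arXiv:0709.3599)] -/
theorem exists_far_vorticityNumber_gt {M η : ℝ}
    (hη : ∀ u : ℝ → EuclideanSpace ℝ (Fin 3) → EuclideanSpace ℝ (Fin 3), IsTypeIAncientMild M u →
      (∀ s : ℝ, s < 0 → ∀ y : EuclideanSpace ℝ (Fin 3), (0 - s) * ‖curl (u s) y‖ ≤ η) →
        ∀ t : ℝ, t < 0 → ∀ x : EuclideanSpace ℝ (Fin 3), u t x = 0)
    {U : ℝ → EuclideanSpace ℝ (Fin 3) → EuclideanSpace ℝ (Fin 3)} (hU : IsTypeIAncientMild M U)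
    {s₀ : ℝ} (hs₀ : s₀ < 0) {y₀ : EuclideanSpace ℝ (Fin 3)} (hne : U s₀ y₀ ≠ 0) :
    ∃ τ : ℝ, τ < -2 ∧ ∃ y : EuclideanSpace ℝ (Fin 3), η < (0 - τ) * ‖curl (U τ) y‖ := by
  by_contra h
  push Not at h
  have hsh : IsTypeIAncientMild M (fun t => U (t - 2)) := hU.comp_sub_right (by norm_num)
  have hsmall : ∀ s : ℝ, s < 0 → ∀ y : EuclideanSpace ℝ (Fin 3),
      (0 - s) * ‖curl ((fun t => U (t - 2)) s) y‖ ≤ η := by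
    intro s hs y
    have h1 := h (s - 2) (by linarith) y
    have h2 : (0 - s) * ‖curl (U (s - 2)) y‖ ≤ (0 - (s - 2)) * ‖curl (U (s - 2)) y‖ :=
      mul_le_mul_of_nonneg_right (by linarith) (norm_nonneg _)
    exact h2.trans h1
  have hz := hη _ hsh hsmall (-1) (by norm_num)
  have hU3 : U (-3) = 0 := funext fun x => by
    have h1 : U ((-1 : ℝ) - 2) x = 0 := hz x
    rwa [show (-1 : ℝ) - 2 = -3 by norm_num] at h1
  have hall := eq_zero_of_typeIAncientMild_of_curl_eq_zero_on_open hU (by norm_num : (-3 : ℝ) < 0)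
    isOpen_univ univ_nonempty (fun y _ => by rw [hU3]; exact curl_zero y)
  exact hne (hall s₀ hs₀ y₀)

/-! ### §M23(c) The theorem -/

/-- ★★★ **THE WINDOWED FIXED-`δ` DIRECTION-COHERENCE LIOUVILLE THEOREM IN `A_M`** (door N5 of ROUND 66, PROVED):
for every `M` and `R > 0` there is `δ = δ(M,R) > 0` such that every KNSS-gauge Type-I ancient mild solution whose
vorticity directions are `δ`-coherent on the far window `s < −1` — between any two points with non-zero
vorticity at parabolic distance `≤ R√(−s)` — is identically zero.  `δ` is ineffective (two compactness
arguments).  Giga–Miura's Theorem 1.1 (CA)/(CA′) and Barker–Prange's Theorem 3 assume a MODULUS of continuity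
`η(|x−y|/√(−s))` for the direction; here a fixed `δ` suffices, and only on a window.
[cite: GigaMiura2011, Thm 1.1, Prop. 2.2, §3; BarkerPrange2020Alignment, Thm 3 (arXiv:1906.08225 §5);
KochNadirashviliSereginSverak2009, Thm 5.1, Lemma 6.1] -/
theorem windowCoherenceLiouville_holds (M : ℝ) {R : ℝ} (hR : 0 < R) : WindowCoherenceLiouville M R := by
  by_contra hF
  -- (0) negation: for every `δ > 0` a non-zero `δ`-coherent member of `A_M`
  have hneg : ∀ δ : ℝ, 0 < δ →
      ∃ U : ℝ → EuclideanSpace ℝ (Fin 3) → EuclideanSpace ℝ (Fin 3), IsTypeIAncientMild M U ∧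
        (∀ s : ℝ, s < -1 → ∀ x y : EuclideanSpace ℝ (Fin 3),
          curl (U s) x ≠ 0 → curl (U s) y ≠ 0 → ‖y - x‖ ≤ R * √(-s) →
            ‖vorticityDirection (curl (U s)) y - vorticityDirection (curl (U s)) x‖ ≤ δ) ∧
        ∃ s : ℝ, s < 0 ∧ ∃ y : EuclideanSpace ℝ (Fin 3), U s y ≠ 0 := by
    intro δ hδ
    by_contra h
    push Not at h
    exact hF ⟨δ, hδ, h⟩
  choose U hUA hcoh s0 hs0 y0 hy0 using fun j : ℕ => hneg (1 / ((j : ℝ) + 1)) (by positivity)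
  -- (1) (P1): a far time `τ_j < −2` with vorticity number `> η`
  obtain ⟨η, hη, hP1⟩ := smallVorticityNumberLiouville_holds M
  choose τ hτ yc hyc using fun j : ℕ => exists_far_vorticityNumber_gt hP1 (hUA j) (hs0 j) (hy0 j)
  -- (2) normalisation `v_j(s,y) = λ_j U_j(λ_j² s, λ_j y + y_j)`, `λ_j² = −τ_j/2 ≥ 1`
  have hτpos : ∀ j, 0 < -τ j / 2 := fun j => by linarith [hτ j]
  obtain ⟨lam, hlam⟩ : ∃ lam : ℕ → ℝ, lam = fun j => Real.sqrt (-τ j / 2) := ⟨_, rfl⟩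
  have hlam0 : ∀ j, 0 < lam j := fun j => by rw [hlam]; exact Real.sqrt_pos.2 (hτpos j)
  have hlam2 : ∀ j, lam j ^ 2 = -τ j / 2 := fun j => by rw [hlam]; exact Real.sq_sqrt (hτpos j).le
  have hlam1 : ∀ j, 1 ≤ lam j := fun j => by
    rw [hlam, show (1 : ℝ) = Real.sqrt 1 from Real.sqrt_one.symm]
    exact Real.sqrt_le_sqrt (by linarith [hτ j])
  obtain ⟨v, hv⟩ : ∃ v : ℕ → ℝ → EuclideanSpace ℝ (Fin 3) → EuclideanSpace ℝ (Fin 3),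
      ∀ j, v j = nsRescale (lam j) (fun t x => U j t (x + yc j)) := ⟨_, fun _ => rfl⟩
  have hvA : ∀ j, IsTypeIAncientMild M (v j) := fun j => by
    rw [hv]; exact ((hUA j).comp_add_right (yc j)).nsRescale (hlam0 j)
  have hcurlv : ∀ j s y, curl (v j s) y = lam j ^ 2 • curl (U j (lam j ^ 2 * s)) (lam j • y + yc j) := by
    intro j s y
    rw [hv, curl_nsRescale]
    -- LANDING NOTE (ns-s30-p1 g6): the text cites N3's `curl_comp_add_right₆₆`, deleted at landing (gate `dedup.landed`);
    -- the identical S-lane lemma `curl_comp_add_right_apply` (p713178) is used instead.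
    simp only [curl_comp_add_right_apply]
  have hnormv : ∀ j s y, ‖curl (v j s) y‖ = lam j ^ 2 * ‖curl (U j (lam j ^ 2 * s)) (lam j • y + yc j)‖ :=
    fun j s y => by rw [hcurlv, norm_smul, Real.norm_of_nonneg (sq_nonneg _)]
  have hdirv : ∀ j s y, vorticityDirection (curl (v j s)) y =
      vorticityDirection (curl (U j (lam j ^ 2 * s))) (lam j • y + yc j) := fun j s y => by
    -- LANDING NOTE (ns-s30-p1 g6): the text's helper `inv_norm_smul_smul_of_pos₆₇` restates landed lemmas in BOTH its
    -- forms (ℝ³: a ClockStretchingLaw module; general normed space: `Literature.AlgebraicTopology.SingularHomology.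
    -- inv_norm_smul_smul`) — gate `dedup.landed` (p716755) — and importing either module into the NS lane for three
    -- lines is not worth the dependency, so the computation is a local `have`; statements byte-identical.
    have hinv₆₇ : ∀ {c : ℝ}, 0 < c → ∀ v : EuclideanSpace ℝ (Fin 3), ‖c • v‖⁻¹ • (c • v) = ‖v‖⁻¹ • v :=
      fun {c} hc v => by
        by_cases hv : v = 0
        · simp [hv]
        · rw [norm_smul, Real.norm_eq_abs, abs_of_pos hc, mul_inv, smul_smul, mul_comm c⁻¹, mul_assoc,
            inv_mul_cancel₀ hc.ne', mul_one]
    rw [vorticityDirection_apply, vorticityDirection_apply, hcurlv, hinv₆₇ (pow_pos (hlam0 j) 2)]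
  have hnev : ∀ j s y, curl (v j s) y ≠ 0 → curl (U j (lam j ^ 2 * s)) (lam j • y + yc j) ≠ 0 := by
    intro j s y h h0
    exact h (by rw [hcurlv, h0, smul_zero])
  have ht2 : ∀ j, lam j ^ 2 * (-2) = τ j := fun j => by rw [hlam2]; ring
  -- the floor at `(−2, 0)`
  have hfloor : ∀ j, η / 2 < ‖curl (v j (-2)) 0‖ := fun j => by
    rw [hnormv, smul_zero, zero_add, ht2, hlam2]
    have h1 := hyc j
    have h2 : -τ j / 2 * ‖curl (U j (τ j)) (yc j)‖ = ((0 - τ j) * ‖curl (U j (τ j)) (yc j)‖) / 2 := by ring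
    rw [h2]; linarith
  -- coherence of `v_j(−2)` for pairs at distance `≤ R` off the zero set
  have hcohv : ∀ j (y y' : EuclideanSpace ℝ (Fin 3)), curl (v j (-2)) y ≠ 0 → curl (v j (-2)) y' ≠ 0 →
      ‖y' - y‖ ≤ R →
        ‖vorticityDirection (curl (v j (-2))) y' - vorticityDirection (curl (v j (-2))) y‖ ≤ 1 / ((j : ℝ) + 1) := by
    intro j y y' hy hy' hd
    have hY := hnev j (-2) y hy
    have hY' := hnev j (-2) y' hy'
    rw [hdirv, hdirv]
    rw [ht2] at hY hY' ⊢
    refine hcoh j (τ j) (by linarith [hτ j]) _ _ hY hY' ?_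
    rw [add_sub_add_right_eq_sub, ← smul_sub, norm_smul, Real.norm_of_nonneg (hlam0 j).le]
    have hsq : √(-τ j) = lam j * √2 := by
      rw [show -τ j = (-τ j / 2) * 2 by ring, Real.sqrt_mul (hτpos j).le, hlam]
    have h2 : (1 : ℝ) ≤ √2 := by
      rw [show (1 : ℝ) = Real.sqrt 1 from Real.sqrt_one.symm]; exact Real.sqrt_le_sqrt (by norm_num)
    calc lam j * ‖y' - y‖ ≤ lam j * R := mul_le_mul_of_nonneg_left hd (hlam0 j).le
      _ ≤ lam j * R * √2 := le_mul_of_one_le_right (mul_nonneg (hlam0 j).le hR.le) h2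
      _ = R * √(-τ j) := by rw [hsq]; ring
  -- (3) compactness (P2)
  obtain ⟨W, φ, hφ, hW, hlim⟩ := typeIAncientCompactness_holds M v hvA
  have h2 : (-2 : ℝ) < 0 := by norm_num
  obtain ⟨e, he_def⟩ : ∃ e : EuclideanSpace ℝ (Fin 3), curl (W (-2)) 0 = e := ⟨_, rfl⟩
  have hρ : Tendsto (fun j => ‖curl (v (φ j) (-2)) 0‖) atTop (𝓝 ‖e‖) := by
    have h1 := ((hlim (-2) h2 0).2).norm
    rwa [he_def] at h1
  have hηe : η / 2 ≤ ‖e‖ := ge_of_tendsto hρ (Eventually.of_forall fun j => (hfloor (φ j)).le)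
  have he : e ≠ 0 := norm_pos_iff.1 (by linarith)
  -- (4) the open set `B(0,R) ∩ {curl W(−2) ≠ 0}`
  have hcW : Continuous (curl (W (-2))) := by
    have h3 : ContDiff ℝ 1 (W (-2)) := (hW.contDiff_slice h2).of_le (by norm_cast)
    exact (contDiff_curl (n := 0) (by exact_mod_cast h3)).continuous
  have hUo : IsOpen (ball (0 : EuclideanSpace ℝ (Fin 3)) R ∩ {y | curl (W (-2)) y ≠ 0}) :=
    isOpen_ball.inter (isOpen_ne_fun hcW continuous_const)
  have he0 : curl (W (-2)) 0 ≠ 0 := by rw [he_def]; exact he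
  have h0U : (0 : EuclideanSpace ℝ (Fin 3)) ∈ ball (0 : EuclideanSpace ℝ (Fin 3)) R ∩ {y | curl (W (-2)) y ≠ 0} :=
    ⟨mem_ball_self hR, he0⟩
  -- (5) directions pass to the limit off the zero set and are constant on the open set
  have hT : ∀ y : EuclideanSpace ℝ (Fin 3), curl (W (-2)) y ≠ 0 →
      Tendsto (fun j => vorticityDirection (curl (v (φ j) (-2))) y) atTop
        (𝓝 (vorticityDirection (curl (W (-2))) y)) := by
    intro y hy
    have h1 := (hlim (-2) h2 y).2
    have h3 := (continuousAt_inv_norm_smul hy).tendsto.comp h1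
    simpa only [Function.comp_def, vorticityDirection_apply] using h3
  have hconst : ∀ y ∈ ball (0 : EuclideanSpace ℝ (Fin 3)) R ∩ {y | curl (W (-2)) y ≠ 0},
      vorticityDirection (curl (W (-2))) y = vorticityDirection (curl (W (-2))) 0 := by
    intro y hy
    have hyR : ‖y‖ < R := mem_ball_zero_iff.1 hy.1
    have hy0 : curl (W (-2)) y ≠ 0 := hy.2
    have hA : ∀ᶠ j in atTop, curl (v (φ j) (-2)) y ≠ 0 := ((hlim (-2) h2 y).2).eventually_ne hy0
    have hB : ∀ᶠ j in atTop, curl (v (φ j) (-2)) 0 ≠ 0 := ((hlim (-2) h2 0).2).eventually_ne he0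
    have hev : ∀ᶠ j in atTop,
        ‖vorticityDirection (curl (v (φ j) (-2))) y - vorticityDirection (curl (v (φ j) (-2))) 0‖ ≤
          1 / ((j : ℝ) + 1) := by
      filter_upwards [hA, hB] with j hjA hjB
      have hd : ‖y - 0‖ ≤ R := by rw [sub_zero]; exact hyR.le
      refine (hcohv (φ j) 0 y hjB hjA hd).trans (one_div_le_one_div_of_le (by positivity) ?_)
      exact_mod_cast Nat.succ_le_succ (hφ.id_le j)
    have hle : ‖vorticityDirection (curl (W (-2))) y - vorticityDirection (curl (W (-2))) 0‖ ≤ 0 :=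
      le_of_tendsto_of_tendsto ((hT y hy0).sub (hT 0 he0)).norm
        (tendsto_one_div_add_atTop_nhds_zero_nat (𝕜 := ℝ)) hev
    exact sub_eq_zero.1 (norm_le_zero_iff.1 hle)
  -- (6) `curl W(−2) ∥ e` on the open set
  have hpar : ∀ y ∈ ball (0 : EuclideanSpace ℝ (Fin 3)) R ∩ {y | curl (W (-2)) y ≠ 0},
      ∃ a : ℝ, curl (W (-2)) y = a • e := by
    intro y hy
    have hy0 : curl (W (-2)) y ≠ 0 := hy.2
    have hξ := hconst y hy
    rw [vorticityDirection_apply, vorticityDirection_apply, he_def] at hξ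
    refine ⟨‖curl (W (-2)) y‖ * ‖e‖⁻¹, ?_⟩
    calc curl (W (-2)) y
        = ‖curl (W (-2)) y‖ • (‖curl (W (-2)) y‖⁻¹ • curl (W (-2)) y) := by
          rw [smul_smul, mul_inv_cancel₀ (norm_ne_zero_iff.2 hy0), one_smul]
      _ = ‖curl (W (-2)) y‖ • (‖e‖⁻¹ • e) := by rw [hξ]
      _ = (‖curl (W (-2)) y‖ * ‖e‖⁻¹) • e := by rw [smul_smul]
  -- (7) the one-slice Liouville theorem: `W ≡ 0`, contradicting `e ≠ 0`
  have hzero := eq_zero_of_typeIAncientMild_of_curl_parallel_on_open hW h2 hUo ⟨0, h0U⟩ he hpar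
  have hW0 : W (-2) = 0 := funext fun x => hzero _ h2 x
  exact he (by rw [← he_def, hW0]; exact curl_zero 0)

/-- ★★★ Unpacked form of `windowCoherenceLiouville_holds`. -/
theorem exists_pos_windowCoherence_liouville (M : ℝ) {R : ℝ} (hR : 0 < R) :
    ∃ δ : ℝ, 0 < δ ∧
      ∀ U : ℝ → EuclideanSpace ℝ (Fin 3) → EuclideanSpace ℝ (Fin 3), IsTypeIAncientMild M U →
        (∀ s : ℝ, s < -1 → ∀ x y : EuclideanSpace ℝ (Fin 3),
          curl (U s) x ≠ 0 → curl (U s) y ≠ 0 → ‖y - x‖ ≤ R * √(-s) →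
            ‖vorticityDirection (curl (U s)) y - vorticityDirection (curl (U s)) x‖ ≤ δ) →
        ∀ s : ℝ, s < 0 → ∀ y : EuclideanSpace ℝ (Fin 3), U s y = 0 :=
  windowCoherenceLiouville_holds M hR

end Summit.NavierStokesRegularity.NavierStokesRegularity.Theorems.StrainDoors

end
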